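import Literature.NumberTheory.EllipticCurves.IwasawaSelmerDualProofs
import Literature.NumberTheory.EllipticCurves.IwasawaGeneratorChangeProofs
import Literature.NumberTheory.EllipticCurves.CharacterModuleQuotientDualityProofs
import Literature.NumberTheory.EllipticCurves.IwasawaAlgebra
import HarnessLib

/-!
# `X(E/K_∞)/q_m X(E/K_∞) ≅ Hom(Sel_{p^∞}(E/K_∞)[(γ−1)^m + p], ℚ/ℤ)`: the `q_m`-coinvariants of the Selmer dual at
# Howard's Eisenstein prime `q_m = T^m + p` (proofs file)

Topic `NumberTheory/EllipticCurves`; the instance, for the tree's `WeierstrassCurve.SelmerDualData`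
(`X = X(E/K_∞) ≅ Hom(Sel_{p^∞}(E/K_∞), ℚ/ℤ)`, `T` acting as `conj_γ − 1`, constants through `ℤ_p → ℤ/p^k`), of the
generic Pontryagin bookkeeping `PontryaginCard.exists_quotSMulTop_addEquiv_characterModule_ker`
(file `CharacterModuleQuotientDualityProofs`): for `q ∈ Λ` acting on `X` as the transpose of an endomorphism `ψ` of
`S = Sel_∞`, `X/qX ≃ Hom(ker ψ, ℚ/ℤ)`. THEOREMS ONLY; no definition, no named fact, no instance, no `sorry`.

For `q_m = T^m + p` (Howard 2004, proof of Thm. 2.2.10: «taking `𝔮 = T^m + p`») the transpose is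
`ψ_m = (conj_γ − 1)^m + p` on `Sel_∞` (`WeierstrassCurve.conjSelmerInfty`):

* `SelmerDualData.toDual_X_smul` — `⟨T x, s⟩ = ⟨x, (conj_γ − 1) s⟩` (powers: the tree's `toDual_X_pow_smul`, file `IwasawaGeneratorChangeProofs`);
* `SelmerDualData.toDual_natCast_smul` — `⟨n x, s⟩ = ⟨x, n s⟩` (`n : ℕ`, every `s` being `p`-power torsion);
* `SelmerDualData.toDual_qm_smul` — `⟨q_m x, s⟩ = ⟨x, ψ_m s⟩`;
* **`SelmerDualData.exists_quotSMulTop_qm_addEquiv_characterModule`** —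
  `X/q_m X ≃+ Hom(ker ψ_m, ℚ/ℤ)`, `Ψ [x] a = ⟨x, a⟩` (Greenberg's «`X/θ_n X` is the Pontryagin dual of `Sel^{Γ_n}`»,
  LNM 1716 §4 p. 98, with `θ_n` replaced by `q_m`);
* **`SelmerDualData.exists_linearMap_quotSMulTop_qm_characterModule`** — for a `Λ`-module `B` and a comparison
  `ι : B →+ Sel_∞` landing in `ker ψ_m` and compatible with the pairing, the `Λ`-LINEAR dual control map
  `h : X/q_m X → Hom(B, ℚ/ℤ)` with `#ker h = #(ker ψ_m / ι(B))` — the binders `h`, `finite_ker`, `card_ker_le` of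
  the witness interface `HeegnerMuPartStabilized.SpecWitness` at `q_m` (cell `pub/bsd-print-x9`, v9-plan STUB 3,
  DUAL side; Howard Lemma 2.2.7 second map / Prop. 2.2.8).

Cell `pub/bsd-print-x9`, seat `bsd-line-x9-p1-w2` (g5), crux stmt-BirchSwinnertonDyer-27077.

References: [GreenbergLNM1716] §4 p. 98, §1 p. 60; [Howard2004HeegnerKolyvagin] Lemma 2.2.7, Prop. 2.2.8, proof of
Thm. 2.2.10 (𝔮 = T^m + p).
-/

noncomputable section

open scoped Classical

universe u

namespace WeierstrassCurve

namespace SelmerDualData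

open Literature.NumberTheory.EllipticCurves Field

variable {K : Type u} [Field K] [NumberField K] {W : WeierstrassCurve K} {p : ℕ} [hp : Fact p.Prime]
  {κ : ZpExtension K p} {γ : absoluteGaloisGroup K} (D : W.SelmerDualData κ γ)

/-- **`⟨T • x, s⟩ = ⟨x, (conj_γ − 1) s⟩`** (the field `toDual_T_smul`, in endomorphism form).
[cite: GreenbergLNM1716, §1 p. 60] -/
theorem toDual_X_smul (x : D.X) (s : W.selmerInfty κ) :
    D.toDual ((PowerSeries.X : IwasawaAlgebra p) • x) s = D.toDual x ((W.conjSelmerInfty κ γ - 1) s) := by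
  have h1 : (W.conjSelmerInfty κ γ - 1) s = W.conjSelmerInfty κ γ s - s := rfl
  have h2 : W.conjSelmerInfty κ γ s = ⟨W.conjH1 p κ.kerSubgroup γ s, D.conj_mem s s.2⟩ := rfl
  rw [h1, map_sub, h2, D.toDual_T_smul]

/-- Every class of `Sel_{p^∞}(E/K_∞)` is killed by a power of `p` (tree
`exists_pow_smul_subgroupH1_ker_eq_zero`, restated inside the Selmer subgroup). [cite: GreenbergLNM1716, §1 p. 60] -/
theorem exists_pow_smul_selmerInfty_eq_zero (s : W.selmerInfty κ) : ∃ k : ℕ, p ^ k • s = 0 := by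
  obtain ⟨k, hk⟩ := W.exists_pow_smul_subgroupH1_ker_eq_zero κ (s : W.subgroupH1 p κ.kerSubgroup)
  exact ⟨k, Subtype.ext (by rw [AddSubmonoidClass.coe_nsmul, hk]; rfl)⟩

/-- **`⟨n • x, s⟩ = ⟨x, n • s⟩` for `n : ℕ`** (constants act through `ℤ_p → ℤ/p^k` on the `p^k`-torsion class `s`,
field `toDual_C_smul`). [cite: GreenbergLNM1716, §1 p. 60] -/
theorem toDual_natCast_smul (n : ℕ) (x : D.X) (s : W.selmerInfty κ) :
    D.toDual ((n : IwasawaAlgebra p) • x) s = D.toDual x (n • s) := by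
  obtain ⟨k, hk⟩ := exists_pow_smul_selmerInfty_eq_zero (W := W) (κ := κ) s
  have hC : (n : IwasawaAlgebra p) = PowerSeries.C (n : ℤ_[p]) := (map_natCast _ n).symm
  rw [hC, D.toDual_C_smul (n : ℤ_[p]) x s k hk, map_natCast, ZMod.val_natCast, map_nsmul]
  -- `(n % p^k) • t = n • t` for `t = ⟨x, s⟩`, killed by `p^k`
  have ht : p ^ k • D.toDual x s = 0 := by rw [← map_nsmul, hk, map_zero]
  conv_rhs => rw [← Nat.mod_add_div n (p ^ k), add_nsmul, mul_nsmul, ht, nsmul_zero, add_zero]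

/-- **`⟨q_m • x, s⟩ = ⟨x, ψ_m s⟩` with `ψ_m = (conj_γ − 1)^m + p`** — the Eisenstein element `q_m = T^m + p` acts on
`X(E/K_∞)` as the transpose of `(conj_γ − 1)^m + p` on `Sel_{p^∞}(E/K_∞)`.
[cite: Howard2004HeegnerKolyvagin, proof of Thm. 2.2.10 (𝔮 = T^m + p)] [cite: GreenbergLNM1716, §4 p. 98] -/
theorem toDual_qm_smul (m : ℕ) (x : D.X) (s : W.selmerInfty κ) :
    D.toDual ((PowerSeries.X ^ m + PowerSeries.C (p : ℤ_[p]) : IwasawaAlgebra p) • x) s =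
      D.toDual x (((W.conjSelmerInfty κ γ - 1) ^ m + (p : AddMonoid.End (W.selmerInfty κ))) s) := by
  rw [add_smul, map_add, AddMonoidHom.add_apply, D.toDual_X_pow_smul, map_natCast, D.toDual_natCast_smul]
  change _ = D.toDual x (((W.conjSelmerInfty κ γ - 1) ^ m) s + (p : AddMonoid.End (W.selmerInfty κ)) s)
  rw [AddMonoid.End.natCast_apply, map_add]

/-- **`X/q_m X ≃ Hom(Sel_∞[ψ_m], ℚ/ℤ)`**: the `q_m`-coinvariants of the Selmer dual are the Pontryagin dual of the
kernel of `ψ_m = (conj_γ − 1)^m + p` on `Sel_{p^∞}(E/K_∞)`, by restriction of characters (`Ψ [x] a = ⟨x, a⟩`) —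
Greenberg's «`X/θ_n X` is the Pontryagin dual of `Sel_E(F_∞)_p^{Γ_n}`» with `θ_n` replaced by Howard's `q_m`.
[cite: GreenbergLNM1716, §4 p. 98] [cite: Howard2004HeegnerKolyvagin, Lemma 2.2.7 and proof of Thm. 2.2.10 (𝔮 = T^m + p)] -/
theorem exists_quotSMulTop_qm_addEquiv_characterModule (m : ℕ) :
    ∃ Ψ : (D.X ⧸ ((Ideal.span {(PowerSeries.X ^ m + PowerSeries.C (p : ℤ_[p]) : IwasawaAlgebra p)} :
        Ideal (IwasawaAlgebra p)) • (⊤ : Submodule (IwasawaAlgebra p) D.X))) ≃+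
        CharacterModule ↥(((W.conjSelmerInfty κ γ - 1) ^ m + (p : AddMonoid.End (W.selmerInfty κ))).ker),
      ∀ (x : D.X) (a : (((W.conjSelmerInfty κ γ - 1) ^ m + (p : AddMonoid.End (W.selmerInfty κ))).ker)),
        Ψ (Submodule.Quotient.mk x) a = D.toDual x a :=
  PontryaginCard.exists_quotSMulTop_addEquiv_characterModule_ker D.toDual D.bijective _ _ (D.toDual_qm_smul m)

/-- **The dual control map at `q_m`.** For a `Λ`-module `B` (the discrete specialised Selmer group `H¹_{F_q}(K, A_q)` in
the port) and an additive comparison `ι : B → Sel_{p^∞}(E/K_∞)` landing in `ker ψ_m` and compatible with the pairing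
(`⟨f • x, ι b⟩ = ⟨x, ι (f • b)⟩`), there is a `Λ`-LINEAR `h : X/q_m X → Hom(B, ℚ/ℤ)`, `h [x] = ⟨x, ι ·⟩`, whose kernel is
finite iff `ker ψ_m / ι(B)` is, of the same cardinality — the binders `h`, `finite_ker`, `card_ker_le` of the tree's
`HeegnerMuPartStabilized.SpecWitness` at `q_m`. [cite: Howard2004HeegnerKolyvagin, Lemma 2.2.7 and Prop. 2.2.8]
[cite: GreenbergLNM1716, §4 p. 98] -/
theorem exists_linearMap_quotSMulTop_qm_characterModule (m : ℕ) {B : Type*} [AddCommGroup B]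
    [Module (IwasawaAlgebra p) B] (ι : B →+ W.selmerInfty κ)
    (hι : ∀ b : B, ((W.conjSelmerInfty κ γ - 1) ^ m + (p : AddMonoid.End (W.selmerInfty κ))) (ι b) = 0)
    (hιΛ : ∀ (f : IwasawaAlgebra p) (x : D.X) (b : B), D.toDual (f • x) (ι b) = D.toDual x (ι (f • b))) :
    ∃ h : (D.X ⧸ ((Ideal.span {(PowerSeries.X ^ m + PowerSeries.C (p : ℤ_[p]) : IwasawaAlgebra p)} :
        Ideal (IwasawaAlgebra p)) • (⊤ : Submodule (IwasawaAlgebra p) D.X))) →ₗ[IwasawaAlgebra p]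
        CharacterModule B,
      (∀ (x : D.X) (b : B), h (Submodule.Quotient.mk x) b = D.toDual x (ι b)) ∧
      Nat.card (LinearMap.ker h) =
        Nat.card (↥(((W.conjSelmerInfty κ γ - 1) ^ m + (p : AddMonoid.End (W.selmerInfty κ))).ker) ⧸
          (ι.range).addSubgroupOf
            (((W.conjSelmerInfty κ γ - 1) ^ m + (p : AddMonoid.End (W.selmerInfty κ))).ker)) ∧
      (Finite (LinearMap.ker h) ↔
        Finite (↥(((W.conjSelmerInfty κ γ - 1) ^ m + (p : AddMonoid.End (W.selmerInfty κ))).ker) ⧸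
          (ι.range).addSubgroupOf
            (((W.conjSelmerInfty κ γ - 1) ^ m + (p : AddMonoid.End (W.selmerInfty κ))).ker))) :=
  PontryaginCard.exists_linearMap_quotSMulTop_characterModule D.toDual D.bijective _ _ (D.toDual_qm_smul m)
    ι hι hιΛ

end SelmerDualData

end WeierstrassCurve

end
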